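import Literature.Computability.Complexity.InstanceChecker
import Literature.Computability.Complexity.OracleStateMachine
import Literature.Computability.Complexity.OracleClockFst
import Literature.Computability.Complexity.PostBPPNPOracle
import HarnessLib

/-!
# Blum–Kannan's Theorem 7.1: checkable = function-restricted IP ∩ co-function-restricted IP (proof)

Sibling proof file of `InstanceChecker.lean` (D-0014): it discharges the named fact
`Literature.Computability.Complexity.instanceCheckable_iff` —

  `∀ Q, Q.InstanceCheckable ↔ Q ∈ PromiseFrIP ∧ Q.swap ∈ PromiseFrIP`

— as `instanceCheckable_iff_holds`, following the printed proof [Blum–Kannan 1995, Thm. 7.1,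
p. 288; Fortnow–Rompel–Sipser 1994, §3, p. 550]:

* (⇐) "Given function-restricted proof systems for the YES- and for the NO-instances of `π`, the
  checker `C_π^P(x)` asks the program `P` for its answer at `x` and then runs the verifier of the
  claimed side, using `P` (resp. its negation) as the oracle; it says CORRECT iff that verifier
  accepts." Here: `BlumKannan.checkerOf M₁ M₂` — first query `x`; on the answer YES run `M₁` (the
  proof system for `Q`) with the program as oracle, on the answer NO run `M₂` (the proof system
  for `Q.swap`) with every oracle answer negated (`OracleAlg.negAnswers`: the complementary
  program `Aᶜ` decides `Q.swap` iff `A` decides `Q`, `PromiseProblem.isDecidedBy_swap_iff`). The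
  two emulated verifiers are clocked by their own round budgets (`OracleAlg.clockFst`,
  `OracleClockFst.lean`) and fed the prefix of the checker's coins of the right length
  (`truncSndFn`, `CoinTruncation.lean`; a prefix of a uniform string is uniform,
  `uniformProb_take_of_le`), so that the checker's acceptance probability is EXACTLY that of the
  emulated verifier (`BlumKannan.acceptProbOn_checkerOf`).
* (⇒) "Given a checker `C_π`, the verifier asks the oracle whether `x` is a YES-instance; if the
  oracle says NO it rejects, otherwise it runs `C_π` with the oracle as the program and accepts
  iff the checker says CORRECT" (`BlumKannan.proverOf C.alg C`); the proof system for the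
  NO-instances (`Q.swap`) is the same machine with the checker reading negated answers
  (`BlumKannan.proverOf C.alg.negAnswers C`), `BlumKannan.acceptProbOn_proverOf`.

The one new piece of machinery is the step-level combinator `OracleAlg.askThenBranch N₁ N₂`
("ask `x`; on answer bit `1` continue as `N₁`, on `0` as `N₂`") together with
`OracleAlg.negAnswers`; both read the transcript through its flattened answer bits (against a
LANGUAGE oracle every answer is one bit, `PRelSigma.bitsTrans`), so that their step functions are
`FP` string maps assembled from the tree's bricks (`PRelSigma.stepCode_comp_mem_FP`,
`OSM.bitsS`, `iteFn`, `isNilFn`, `take1Fn`, the complementing transducer `PostBPPHash.notT`) — no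
Turing machine is programmed.

## References

* M. Blum, S. Kannan, *Designing programs that check their work*, J. ACM 42 (1995) 269–291,
  §7, Thm. 7.1 (p. 288).
* L. Fortnow, J. Rompel, M. Sipser, *On the power of multi-prover interactive protocols*,
  Theoret. Comput. Sci. 134 (1994) 545–557, §3 (p. 550: "a language `L` has an instance checker
  if both `L` and `L̄` have function-restricted interactive proof systems"; conversely Cor. 3.2).
* S. Arora, B. Barak, *Computational Complexity: A Modern Approach*, CUP 2009, §8.6 (Def. 8.26),
  §3.4 (oracle machines), §7.1 (irrelevant coins).
-/

namespace Literature.Computability.Complexity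

open _root_.Computability
open Literature.Computability.Cryptography (OracleAdversary)
open PRelSigma

/-! ### Complementary language oracles -/

/-- The indicator of the complement is the negated indicator. [folklore] -/
theorem boolIndicator_compl (A : Language Bool) (q : List Bool) :
    Aᶜ.boolIndicator q = !A.boolIndicator q := by
  by_cases h : q ∈ A
  · rw [(Set.mem_iff_boolIndicator A q).1 h,
      (Set.notMem_iff_boolIndicator (Aᶜ : Language Bool) q).1 fun hc => hc h]
    rfl
  · rw [(Set.notMem_iff_boolIndicator A q).1 h,
      (Set.mem_iff_boolIndicator (Aᶜ : Language Bool) q).1 h]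
    rfl

/-- The oracle of the complementary language answers with the negated bit. [folklore] -/
theorem ofLanguage_compl_apply (A : Language Bool) (q : List Bool) :
    Oracle.ofLanguage Aᶜ q = [!A.boolIndicator q] := by
  rw [ofLanguage_eq_singleton, boolIndicator_compl]

namespace BlumKannan

/-! ### Bitwise complement is a finite-state map -/

/-- **Bitwise complement is in `FP`**: it is the transduction of the one-state transducer
`PostBPPHash.notT` (`PostBPPNPOracle.lean`). [Arora–Barak 2009, §1.3] [folklore] -/
theorem map_not_mem_FP : (fun l : List Bool => l.map (! ·)) ∈ FP := by
  have h : (fun l : List Bool => l.map (! ·)) = PostBPPHash.notT.eval :=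
    funext fun l => (PostBPPHash.notT_eval l).symm
  rw [h]
  exact PostBPPHash.notT_mem_FP

end BlumKannan

namespace OracleAlg

/-! ### Reading negated answers (the complementary program as oracle) -/

/-- **`N.negAnswers`**: run `N` on the NEGATED answer bits — against the program `A` (oracle
`Oracle.ofLanguage A`) it is `N` run against the complementary program `Aᶜ` (`run_negAnswers`).
The transcript is read through its flattened bits (one bit per answer of a language oracle).
[Blum–Kannan 1995, §7 (co-function-restricted IP: the prover's answers negated)]
[cite: BlumKannan1995, §7 (p. 288)] -/
def negAnswers (N : OracleAlg Bool) : OracleAlg Bool where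
  step w as := N.step w (bitsTrans (as.flatten.map (! ·)))

/-- The step of `N.negAnswers` (definitional). [folklore] -/
theorem negAnswers_step (N : OracleAlg Bool) (w : List Bool) (as : List (List Bool)) :
    N.negAnswers.step w as = N.step w (bitsTrans (as.flatten.map (! ·))) :=
  rfl

/-- **Run semantics of `negAnswers`** against a language oracle, along any transcript.
[cite: BlumKannan1995, §7 (p. 288)] -/
theorem runAux_negAnswers (N : OracleAlg Bool) (A : Language Bool) (w : List Bool) :
    ∀ (n : ℕ) (as : List (List Bool)),
      N.negAnswers.runAux (Oracle.ofLanguage A) w n as =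
        N.runAux (Oracle.ofLanguage Aᶜ) w n (bitsTrans (as.flatten.map (! ·)))
  | 0, _ => rfl
  | n + 1, as => by
    rw [runAux_succ, runAux_succ, negAnswers_step]
    cases N.step w (bitsTrans (as.flatten.map (! ·))) with
    | inr b => rfl
    | inl q =>
      dsimp only
      rw [runAux_negAnswers N A w n (as ++ [Oracle.ofLanguage A q]), ofLanguage_eq_singleton A q,
        ofLanguage_compl_apply A q]
      simp [bitsTrans_append]

/-- Hence `N.negAnswers` against `A` runs as `N` against `Aᶜ`. [cite: BlumKannan1995, §7 (p. 288)] -/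
theorem run_negAnswers (N : OracleAlg Bool) (A : Language Bool) (n : ℕ) (w : List Bool) :
    N.negAnswers.run (Oracle.ofLanguage A) n w = N.run (Oracle.ofLanguage Aᶜ) n w := by
  have h := runAux_negAnswers N A w n []
  simpa [run] using h

/-- **`N.negAnswers` is polynomial-time** when `N` is: its step code is
`v ↦ code (N.step (xS v) (bitsTrans ((bitsS v).map not)))` (`stepCode_comp_mem_FP`).
[Arora–Barak 2009, §3.4 with §1.3] [folklore] -/
theorem isPolyTime_negAnswers {N : OracleAlg Bool} (hN : N.IsPolyTime encodingBoolBool) :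
    N.negAnswers.IsPolyTime encodingBoolBool := by
  have hG : (fun v => stepCode (N.step (OSM.xS v) (bitsTrans ((OSM.bitsS v).map (! ·))))) ∈ FP :=
    stepCode_comp_mem_FP N hN OSM.xS_mem_FP (comp_mem_FP BlumKannan.map_not_mem_FP OSM.bitsS_mem_FP)
  obtain ⟨p, Mx, h⟩ := hG
  refine ⟨p, Mx, fun a => ?_⟩
  obtain ⟨w, as⟩ := a
  have ha := h (boolPair w ((encodingList Bool).listBool.encode as))
  simp only [id, OSM.xS_apply, OSM.bitsS_apply] at ha
  exact ha

/-! ### Ask the input, then branch on the answer bit -/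

/-- The step of `askThenBranch N₁ N₂` on the flattened answer bits: no bit yet ↦ ask
`x = (boolUnpair w).1`; first bit `b` ↦ the step of `N₁` (`b = 1`) or `N₂` (`b = 0`) on the later
bits. [cite: BlumKannan1995, Thm. 7.1 (p. 288)] -/
def branchStep (N₁ N₂ : OracleAlg Bool) (w : List Bool) : List Bool → List Bool ⊕ Bool
  | [] => Sum.inl (boolUnpair w).1
  | b :: bits => (cond b N₁ N₂).step w (bitsTrans bits)

/-- `branchStep` with no answer bit asks `x`. [folklore] -/
@[simp] theorem branchStep_nil (N₁ N₂ : OracleAlg Bool) (w : List Bool) :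
    branchStep N₁ N₂ w [] = Sum.inl (boolUnpair w).1 :=
  rfl

/-- `branchStep` after the first answer bit `b` is the step of the selected algorithm. [folklore] -/
@[simp] theorem branchStep_cons (N₁ N₂ : OracleAlg Bool) (w : List Bool) (b : Bool) (bits : List Bool) :
    branchStep N₁ N₂ w (b :: bits) = (cond b N₁ N₂).step w (bitsTrans bits) :=
  rfl

/-- **`askThenBranch N₁ N₂`**: on input `w = ⟨x, r⟩` first ask the query `x`; if the answer bit
is `1` continue as `N₁`, if it is `0` continue as `N₂`, either one run on `w` and on the answers
received AFTER the first (read through their flattened bits, `branchStep`). This is the common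
shape of both halves of Blum–Kannan's proof: "ask the program / the oracle for its answer at `x`,
then run the proof system of the claimed side / the checker". [cite: BlumKannan1995, Thm. 7.1 (p. 288)] -/
def askThenBranch (N₁ N₂ : OracleAlg Bool) : OracleAlg Bool where
  step w as := branchStep N₁ N₂ w as.flatten

/-- The step of `askThenBranch N₁ N₂` (definitional). [folklore] -/
theorem askThenBranch_step (N₁ N₂ : OracleAlg Bool) (w : List Bool) (as : List (List Bool)) :
    (askThenBranch N₁ N₂).step w as = branchStep N₁ N₂ w as.flatten :=
  rfl

/-- The first step of `askThenBranch N₁ N₂` asks `x = (boolUnpair w).1`. [folklore] -/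
theorem askThenBranch_step_nil (N₁ N₂ : OracleAlg Bool) (w : List Bool) :
    (askThenBranch N₁ N₂).step w [] = Sum.inl (boolUnpair w).1 :=
  rfl

/-- After a one-bit first answer `b`, `askThenBranch N₁ N₂` steps as the selected algorithm on the
later answer bits. [folklore] -/
theorem askThenBranch_step_cons (N₁ N₂ : OracleAlg Bool) (w : List Bool) (b : Bool)
    (as : List (List Bool)) :
    (askThenBranch N₁ N₂).step w ([b] :: as) = (cond b N₁ N₂).step w (bitsTrans as.flatten) := by
  rw [askThenBranch_step, List.flatten_cons, List.singleton_append, branchStep_cons]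

/-- **Run semantics of `askThenBranch` after the first answer**, against a language oracle: with
the one-bit first answer `b` in hand it runs as the selected algorithm on the later answers.
[cite: BlumKannan1995, Thm. 7.1 (p. 288)] -/
theorem runAux_askThenBranch_cons (N₁ N₂ : OracleAlg Bool) (A : Language Bool) (w : List Bool)
    (b : Bool) :
    ∀ (n : ℕ) (as : List (List Bool)),
      (askThenBranch N₁ N₂).runAux (Oracle.ofLanguage A) w n ([b] :: as) =
        (cond b N₁ N₂).runAux (Oracle.ofLanguage A) w n (bitsTrans as.flatten)
  | 0, _ => rfl
  | n + 1, as => by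
    rw [runAux_succ, runAux_succ, askThenBranch_step_cons]
    cases (cond b N₁ N₂).step w (bitsTrans as.flatten) with
    | inr b' => rfl
    | inl q =>
      dsimp only
      rw [List.cons_append, runAux_askThenBranch_cons N₁ N₂ A w b n (as ++ [Oracle.ofLanguage A q]),
        ofLanguage_eq_singleton A q]
      simp [bitsTrans_append]

/-- **Run semantics of `askThenBranch`** against the program `A`: one round for the query `x`,
then the run of `N₁` if `x ∈ A` and of `N₂` if `x ∉ A`. [cite: BlumKannan1995, Thm. 7.1 (p. 288)] -/
theorem run_askThenBranch (N₁ N₂ : OracleAlg Bool) (A : Language Bool) (n : ℕ) (w : List Bool) :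
    (askThenBranch N₁ N₂).run (Oracle.ofLanguage A) (n + 1) w =
      (cond (A.boolIndicator (boolUnpair w).1) N₁ N₂).run (Oracle.ofLanguage A) n w := by
  change (askThenBranch N₁ N₂).runAux (Oracle.ofLanguage A) w (n + 1) [] =
    (cond (A.boolIndicator (boolUnpair w).1) N₁ N₂).runAux (Oracle.ofLanguage A) w n []
  rw [runAux_succ, askThenBranch_step_nil]
  dsimp only
  rw [List.nil_append, ofLanguage_eq_singleton A (boolUnpair w).1, runAux_askThenBranch_cons]
  rfl

/-- The step of `askThenBranch N₁ N₂` as a string map on the code `v = ⟨w, ⟨1^{#as}, body as⟩⟩`: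
no answer bit yet ↦ `0 x`; otherwise the step code of the selected algorithm on the later bits.
[folklore] -/
noncomputable def askThenBranchFn (N₁ N₂ : OracleAlg Bool) : List Bool → List Bool :=
  iteFn (Brick.isNilFn ∘ OSM.bitsS) (List.cons false ∘ fstP ∘ fstP)
    (iteFn (take1Fn ∘ OSM.bitsS)
      (fun v => stepCode (N₁.step (fstP v) (bitsTrans (OSM.bitsS v).tail)))
      (fun v => stepCode (N₂.step (fstP v) (bitsTrans (OSM.bitsS v).tail))))

/-- `askThenBranchFn N₁ N₂ ∈ FP` for polynomial-time `N₁`, `N₂`. [Arora–Barak 2009, §1.3] [folklore] -/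
theorem askThenBranchFn_mem_FP {N₁ N₂ : OracleAlg Bool} (h₁ : N₁.IsPolyTime encodingBoolBool)
    (h₂ : N₂.IsPolyTime encodingBoolBool) : askThenBranchFn N₁ N₂ ∈ FP :=
  iteFn_mem_FP (comp_mem_FP Brick.isNilFn_mem_FP OSM.bitsS_mem_FP)
    (comp_mem_FP (cons_mem_FP false) (comp_mem_FP fstP_mem_FP fstP_mem_FP))
    (iteFn_mem_FP (comp_mem_FP take1Fn_mem_FP OSM.bitsS_mem_FP)
      (stepCode_comp_mem_FP N₁ h₁ fstP_mem_FP (comp_mem_FP tail_mem_FP OSM.bitsS_mem_FP))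
      (stepCode_comp_mem_FP N₂ h₂ fstP_mem_FP (comp_mem_FP tail_mem_FP OSM.bitsS_mem_FP)))

/-- **`askThenBranchFn` computes the step code of `askThenBranch`.** [folklore] -/
theorem askThenBranchFn_apply (N₁ N₂ : OracleAlg Bool) (w : List Bool) (as : List (List Bool)) :
    askThenBranchFn N₁ N₂ (boolPair w ((encodingList Bool).listBool.encode as)) =
      stepCode ((askThenBranch N₁ N₂).step w as) := by
  have hbits : OSM.bitsS (boolPair w ((encodingList Bool).listBool.encode as)) = as.flatten :=
    OSM.bitsS_apply w as
  rw [askThenBranch_step]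
  unfold askThenBranchFn
  cases hfl : as.flatten with
  | nil =>
    rw [iteFn_apply_true (by simp [Function.comp_apply, hbits, hfl, Brick.isNilFn])]
    simp [fstP]
  | cons b bits =>
    rw [iteFn_apply_false (by simp [Function.comp_apply, hbits, hfl, Brick.isNilFn])]
    cases b with
    | true =>
      rw [iteFn_apply_true (by simp [Function.comp_apply, hbits, hfl, take1Fn])]
      simp [hbits, hfl, fstP]
    | false =>
      rw [iteFn_apply_false (by simp [Function.comp_apply, hbits, hfl, take1Fn])]
      simp [hbits, hfl, fstP]

/-- **`askThenBranch N₁ N₂` is polynomial-time** when `N₁` and `N₂` are.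
[Arora–Barak 2009, §3.4 with §1.3] [folklore] -/
theorem isPolyTime_askThenBranch {N₁ N₂ : OracleAlg Bool} (h₁ : N₁.IsPolyTime encodingBoolBool)
    (h₂ : N₂.IsPolyTime encodingBoolBool) : (askThenBranch N₁ N₂).IsPolyTime encodingBoolBool := by
  obtain ⟨p, Mx, h⟩ := askThenBranchFn_mem_FP h₁ h₂
  refine ⟨p, Mx, fun a => ?_⟩
  obtain ⟨w, as⟩ := a
  have ha := h (boolPair w ((encodingList Bool).listBool.encode as))
  simp only [id, askThenBranchFn_apply] at ha
  exact ha

/-! ### The rejecting algorithm -/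

/-- The query-free algorithm rejecting at once. [folklore] -/
def rejectAlg : OracleAlg Bool :=
  ofFun fun _ => false

/-- `rejectAlg` never accepts. [folklore] -/
theorem run_rejectAlg_ne (O : Oracle) (k : ℕ) (w : List Bool) : rejectAlg.run O k w ≠ some true := by
  cases k with
  | zero => exact fun h => by cases h
  | succ k => rw [rejectAlg, run_ofFun_succ]; exact fun h => by cases h

/-- `rejectAlg` is polynomial-time (a constant step function). [folklore] -/
theorem isPolyTime_rejectAlg : rejectAlg.IsPolyTime encodingBoolBool := by
  have hc : PolyTimeComputable (id : List Bool → List Bool) encodingBoolBool.encode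
      (fun _ : List Bool => false) := by
    obtain ⟨p, Mx, h⟩ := const_mem_FP [false]
    exact ⟨p, Mx, fun v => h v⟩
  exact isPolyTime_ofFun_holds hc

end OracleAlg

namespace BlumKannan

open OracleAlg

/-! ### From a checker to the two proof systems -/

/-- **The verifier built from a checker** (Blum–Kannan, proof of Thm. 7.1, ⇒): ask the oracle
for its answer at `x`; on NO reject, on YES run `N` (the checker's algorithm, or the checker
reading negated answers) with the same coins and accept iff it says CORRECT. One more round than
the checker, the same coins. [cite: BlumKannan1995, Thm. 7.1 (p. 288)] -/
noncomputable def proverOf (N : OracleAlg Bool) (C : OracleAdversary Bool) : OracleAdversary Bool where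
  alg := askThenBranch N rejectAlg
  coins := C.coins
  fuel := C.fuel + 1

/-- **Acceptance probability of the verifier built from a checker, oracle says YES at `x`**:
that of `N` run with the checker's budgets. [cite: BlumKannan1995, Thm. 7.1 (p. 288)] -/
theorem acceptProbOn_proverOf_of_mem (N : OracleAlg Bool) (C : OracleAdversary Bool)
    {A : Language Bool} {x : List Bool} (hx : x ∈ A) :
    (proverOf N C).acceptProbOn (Oracle.ofLanguage A) x =
      (⟨N, C.coins, C.fuel⟩ : OracleAdversary Bool).acceptProbOn (Oracle.ofLanguage A) x := by
  rw [OracleAdversary.acceptProbOn_eq, OracleAdversary.acceptProbOn_eq]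
  simp only [proverOf, Polynomial.eval_add, Polynomial.eval_one]
  congr 1
  ext r
  simp only [Set.mem_setOf_eq]
  rw [run_askThenBranch, boolUnpair_boolPair, (Set.mem_iff_boolIndicator A x).1 hx]
  rfl

/-- **Acceptance probability of the verifier built from a checker, oracle says NO at `x`**: `0`
(it rejects at once). [cite: BlumKannan1995, Thm. 7.1 (p. 288)] -/
theorem acceptProbOn_proverOf_of_not_mem (N : OracleAlg Bool) (C : OracleAdversary Bool)
    {A : Language Bool} {x : List Bool} (hx : x ∉ A) :
    (proverOf N C).acceptProbOn (Oracle.ofLanguage A) x = 0 := by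
  rw [OracleAdversary.acceptProbOn_eq]
  simp only [proverOf, Polynomial.eval_add, Polynomial.eval_one]
  have hset : {r : List Bool | (askThenBranch N rejectAlg).run (Oracle.ofLanguage A)
      (C.fuel.eval x.length + 1) (boolPair x r) = some true} = ∅ := by
    refine Set.eq_empty_of_forall_notMem fun r hr => ?_
    rw [Set.mem_setOf_eq, run_askThenBranch, boolUnpair_boolPair,
      (Set.notMem_iff_boolIndicator A x).1 hx] at hr
    exact run_rejectAlg_ne _ _ _ hr
  rw [hset, uniformProb_empty]

/-- The verifier built from a polynomial-time `N` and checker budgets is PPT. [folklore] -/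
theorem isPPT_proverOf {N : OracleAlg Bool} (hN : N.IsPolyTime encodingBoolBool)
    (C : OracleAdversary Bool) : (proverOf N C).IsPPT encodingBoolBool :=
  isPolyTime_askThenBranch hN isPolyTime_rejectAlg

/-- **(⇒, YES side)** A checker for `Q` yields a function-restricted proof system for `Q`:
completeness because a bug-free program makes the checker say CORRECT, soundness because a
program claiming YES on a NO-instance errs there. [cite: BlumKannan1995, Thm. 7.1 (p. 288)] -/
theorem frProves_proverOf {C : ProbOracleMachine} {Q : PromiseProblem} (hC : IsInstanceChecker C Q) :
    FrProves (proverOf C.alg C) Q := by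
  constructor
  · intro A hA x hx
    rw [acceptProbOn_proverOf_of_mem _ _ (hA.1 x hx)]
    exact (hC A x).1 hA (Or.inl hx)
  · intro A x hx
    by_cases hxA : x ∈ A
    · rw [acceptProbOn_proverOf_of_mem _ _ hxA]
      exact (hC A x).2 (Or.inr ⟨hx, hxA⟩)
    · rw [acceptProbOn_proverOf_of_not_mem _ _ hxA]
      norm_num

/-- **(⇒, NO side)** A checker for `Q` yields a function-restricted proof system for `Q.swap`
(co-function-restricted IP): run the checker with the complementary program.
[cite: BlumKannan1995, Thm. 7.1 (p. 288)] -/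
theorem frProves_proverOf_swap {C : ProbOracleMachine} {Q : PromiseProblem}
    (hC : IsInstanceChecker C Q) : FrProves (proverOf C.alg.negAnswers C) Q.swap := by
  have hneg : ∀ (A : Language Bool) (x : List Bool),
      (⟨C.alg.negAnswers, C.coins, C.fuel⟩ : OracleAdversary Bool).acceptProbOn (Oracle.ofLanguage A) x =
        C.acceptProbOn (Oracle.ofLanguage Aᶜ) x := by
    intro A x
    rw [OracleAdversary.acceptProbOn_eq, OracleAdversary.acceptProbOn_eq]
    simp only [run_negAnswers]
  constructor
  · intro A hA x hx
    rw [PromiseProblem.yes_swap] at hx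
    rw [acceptProbOn_proverOf_of_mem _ _ (hA.1 x (by rwa [PromiseProblem.yes_swap])), hneg]
    exact (hC Aᶜ x).1 (PromiseProblem.isDecidedBy_swap_iff.1 hA) (Or.inr hx)
  · intro A x hx
    rw [PromiseProblem.no_swap] at hx
    by_cases hxA : x ∈ A
    · rw [acceptProbOn_proverOf_of_mem _ _ hxA, hneg]
      exact (hC Aᶜ x).2 (Or.inl ⟨hx, fun h => h hxA⟩)
    · rw [acceptProbOn_proverOf_of_not_mem _ _ hxA]
      norm_num

/-! ### From the two proof systems to a checker -/

/-- The emulated verifier: `M`'s algorithm fed the prefix of the right length of the coins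
(`truncSndFn`) and clocked by its own round budget read off `x` (`clockFst`).
[cite: BlumKannan1995, Thm. 7.1 (p. 288)] -/
noncomputable def emulate (M : OracleAdversary Bool) : OracleAlg Bool :=
  (M.alg.comap (truncSndFn M.coins)).clockFst M.fuel false

/-- **Run of the emulated verifier**: with more rounds than `M`'s budget it outputs whether `M`,
on the coin prefix, accepts within its budget. [cite: AroraBarak2009, §3.4 with §1.4.1] -/
theorem run_emulate (M : OracleAdversary Bool) (O : Oracle) (x r : List Bool) {n : ℕ}
    (hn : M.fuel.eval x.length < n) :
    (emulate M).run O n (boolPair x r) =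
      some ((M.alg.run O (M.fuel.eval x.length)
        (boolPair x (r.take (M.coins.eval x.length)))).getD false) := by
  have hc : (M.alg.comap (truncSndFn M.coins)).run O (M.fuel.eval x.length) (boolPair x r) =
      M.alg.run O (M.fuel.eval x.length) (boolPair x (r.take (M.coins.eval x.length))) := by
    change (M.alg.comap (truncSndFn M.coins)).runAux O (boolPair x r) _ [] = _
    rw [runAux_comap, truncSndFn_boolPair]
    rfl
  rw [emulate, run_clockFst_boolPair _ _ _ _ _ _ hn, hc]

/-- The emulated verifier accepts iff `M` accepts on the coin prefix. [folklore] -/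
theorem run_emulate_eq_some_true_iff (M : OracleAdversary Bool) (O : Oracle) (x r : List Bool)
    {n : ℕ} (hn : M.fuel.eval x.length < n) :
    (emulate M).run O n (boolPair x r) = some true ↔
      M.alg.run O (M.fuel.eval x.length) (boolPair x (r.take (M.coins.eval x.length))) = some true := by
  rw [run_emulate M O x r hn, Option.some.injEq]
  cases M.alg.run O (M.fuel.eval x.length) (boolPair x (r.take (M.coins.eval x.length))) with
  | none => simp
  | some b => simp

/-- The emulated verifier is polynomial-time. [folklore] -/
theorem isPolyTime_emulate {M : OracleAdversary Bool} (hM : M.IsPPT encodingBoolBool) :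
    (emulate M).IsPolyTime encodingBoolBool :=
  isPolyTime_clockFst encodingBoolBool (isPolyTime_comap encodingBoolBool hM (truncSndFn_mem_FP _)) _ _

/-- **The checker built from the two proof systems** (Blum–Kannan, proof of Thm. 7.1, ⇐): ask the
program for its answer at `x`; on YES run the verifier `M₁` of `Q` with the program as oracle, on
NO the verifier `M₂` of `Q.swap` with the complementary program; say CORRECT iff it accepts.
Coins `coins₁ + coins₂`, rounds `fuel₁ + fuel₂ + 2`
(one for the query, one spare for the clocks). [cite: BlumKannan1995, Thm. 7.1 (p. 288)] -/
noncomputable def checkerOf (M₁ M₂ : OracleAdversary Bool) : OracleAdversary Bool where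
  alg := askThenBranch (emulate M₁) (emulate M₂).negAnswers
  coins := M₁.coins + M₂.coins
  fuel := M₁.fuel + M₂.fuel + 1 + 1

/-- The round budget of the checker leaves room for either emulation. [folklore] -/
theorem fuel_checkerOf_eval (M₁ M₂ : OracleAdversary Bool) (n : ℕ) :
    (checkerOf M₁ M₂).fuel.eval n = M₁.fuel.eval n + M₂.fuel.eval n + 1 + 1 := by
  show (M₁.fuel + M₂.fuel + 1 + 1).eval n = _
  rw [Polynomial.eval_add, Polynomial.eval_add, Polynomial.eval_add, Polynomial.eval_one]

/-- **Acceptance probability of the checker, program says YES at `x`**: exactly that of `M₁` with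
the program as oracle (irrelevant coins do not change a probability, `uniformProb_take_of_le`).
[cite: BlumKannan1995, Thm. 7.1 (p. 288)] [cite: AroraBarak2009, §7.1] -/
theorem acceptProbOn_checkerOf_of_mem (M₁ M₂ : OracleAdversary Bool) {A : Language Bool}
    {x : List Bool} (hx : x ∈ A) :
    (checkerOf M₁ M₂).acceptProbOn (Oracle.ofLanguage A) x = M₁.acceptProbOn (Oracle.ofLanguage A) x := by
  rw [OracleAdversary.acceptProbOn_eq, OracleAdversary.acceptProbOn_eq, fuel_checkerOf_eval]
  have h1 : M₁.fuel.eval x.length < M₁.fuel.eval x.length + M₂.fuel.eval x.length + 1 := by omega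
  have hset : {r : List Bool | (checkerOf M₁ M₂).alg.run (Oracle.ofLanguage A)
      (M₁.fuel.eval x.length + M₂.fuel.eval x.length + 1 + 1) (boolPair x r) = some true} =
      {r | r.take (M₁.coins.eval x.length) ∈ {r' : List Bool | M₁.alg.run (Oracle.ofLanguage A)
        (M₁.fuel.eval x.length) (boolPair x r') = some true}} := by
    ext r
    simp only [Set.mem_setOf_eq, checkerOf]
    rw [run_askThenBranch, boolUnpair_boolPair, (Set.mem_iff_boolIndicator A x).1 hx]
    exact run_emulate_eq_some_true_iff M₁ _ x r h1
  rw [hset]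
  simp only [checkerOf, Polynomial.eval_add]
  exact uniformProb_take_of_le (Nat.le_add_right _ _) _

/-- **Acceptance probability of the checker, program says NO at `x`**: exactly that of `M₂` with
the complementary program as oracle. [cite: BlumKannan1995, Thm. 7.1 (p. 288)]
[cite: AroraBarak2009, §7.1] -/
theorem acceptProbOn_checkerOf_of_not_mem (M₁ M₂ : OracleAdversary Bool) {A : Language Bool}
    {x : List Bool} (hx : x ∉ A) :
    (checkerOf M₁ M₂).acceptProbOn (Oracle.ofLanguage A) x = M₂.acceptProbOn (Oracle.ofLanguage Aᶜ) x := by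
  rw [OracleAdversary.acceptProbOn_eq, OracleAdversary.acceptProbOn_eq, fuel_checkerOf_eval]
  have h2 : M₂.fuel.eval x.length < M₁.fuel.eval x.length + M₂.fuel.eval x.length + 1 := by omega
  have hset : {r : List Bool | (checkerOf M₁ M₂).alg.run (Oracle.ofLanguage A)
      (M₁.fuel.eval x.length + M₂.fuel.eval x.length + 1 + 1) (boolPair x r) = some true} =
      {r | r.take (M₂.coins.eval x.length) ∈ {r' : List Bool | M₂.alg.run (Oracle.ofLanguage Aᶜ)
        (M₂.fuel.eval x.length) (boolPair x r') = some true}} := by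
    ext r
    simp only [Set.mem_setOf_eq, checkerOf]
    rw [run_askThenBranch, boolUnpair_boolPair, (Set.notMem_iff_boolIndicator A x).1 hx]
    show (emulate M₂).negAnswers.run _ _ _ = _ ↔ _
    rw [run_negAnswers]
    exact run_emulate_eq_some_true_iff M₂ _ x r h2
  rw [hset]
  simp only [checkerOf, Polynomial.eval_add]
  exact uniformProb_take_of_le (Nat.le_add_left _ _) _

/-- The checker built from PPT verifiers is PPT. [folklore] -/
theorem isPPT_checkerOf {M₁ M₂ : OracleAdversary Bool} (h₁ : M₁.IsPPT encodingBoolBool)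
    (h₂ : M₂.IsPPT encodingBoolBool) : (checkerOf M₁ M₂).IsPPT encodingBoolBool :=
  isPolyTime_askThenBranch (isPolyTime_emulate h₁) (isPolyTime_negAnswers (isPolyTime_emulate h₂))

/-- **(⇐)** Proof systems for `Q` and `Q.swap` yield a checker for `Q`. Clause (1): a bug-free
program `A` answers correctly at `x`, and `A` (resp. `Aᶜ`) is an honest oracle for `Q` (resp.
`Q.swap`), so the selected verifier accepts by completeness. Clause (2): if `A` errs at `x` the
selected verifier is run on a NO-instance of its problem, so it accepts with probability `≤ 1/3`
by soundness against every oracle. [cite: BlumKannan1995, Thm. 7.1 (p. 288)] -/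
theorem isInstanceChecker_checkerOf {M₁ M₂ : ProbOracleMachine} {Q : PromiseProblem}
    (hM₁ : FrProves M₁ Q) (hM₂ : FrProves M₂ Q.swap) : IsInstanceChecker (checkerOf M₁ M₂) Q := by
  intro A x
  constructor
  · intro hA hx
    rcases hx with hx | hx
    · rw [acceptProbOn_checkerOf_of_mem _ _ (hA.1 x hx)]
      exact hM₁.1 A hA x hx
    · rw [acceptProbOn_checkerOf_of_not_mem _ _ (hA.2 x hx)]
      refine hM₂.1 Aᶜ ?_ x (by rwa [PromiseProblem.yes_swap])
      rw [PromiseProblem.isDecidedBy_swap_iff, compl_compl]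
      exact hA
  · intro hx
    rcases hx with ⟨hx, hxA⟩ | ⟨hx, hxA⟩
    · rw [acceptProbOn_checkerOf_of_not_mem _ _ hxA]
      exact hM₂.2 Aᶜ x (by rwa [PromiseProblem.no_swap])
    · rw [acceptProbOn_checkerOf_of_mem _ _ hxA]
      exact hM₁.2 A x hx

end BlumKannan

/-! ### The theorem -/

/-- **Blum–Kannan 1995, Theorem 7.1** (discharge of the named fact `instanceCheckable_iff`):
a decision problem `Q` has an efficient program checker iff both `Q` and `Q.swap` have
polynomial-time function-restricted proof systems — "`π` is checkable ⟺ `π ∈` function-restricted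
IP `∩` co-function-restricted IP"; for languages (FRS94 p. 550): `L` has an instance checker iff
`L` and `L̄` are in `frIP` (`instanceCheckable_iff.language`).
(⇒) `BlumKannan.proverOf`: ask the oracle for its claim at `x`, reject a NO, otherwise run the
checker with the oracle (resp. its negation) as the program. (⇐) `BlumKannan.checkerOf`: ask the
program for its answer at `x` and run the verifier of the claimed side with the program (resp. its
negation) as the oracle. [cite: BlumKannan1995, Thm. 7.1 (p. 288)]
[cite: FortnowRompelSipser1994, §3 (p. 550)] -/
theorem instanceCheckable_iff_holds : instanceCheckable_iff := by
  intro Q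
  constructor
  · rintro ⟨C, hC, hIC⟩
    exact ⟨⟨BlumKannan.proverOf C.alg C, BlumKannan.isPPT_proverOf hC C, BlumKannan.frProves_proverOf hIC⟩,
      ⟨BlumKannan.proverOf C.alg.negAnswers C,
        BlumKannan.isPPT_proverOf (OracleAlg.isPolyTime_negAnswers hC) C,
        BlumKannan.frProves_proverOf_swap hIC⟩⟩
  · rintro ⟨⟨M₁, h₁, hM₁⟩, ⟨M₂, h₂, hM₂⟩⟩
    exact ⟨BlumKannan.checkerOf M₁ M₂, BlumKannan.isPPT_checkerOf h₁ h₂,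
      BlumKannan.isInstanceChecker_checkerOf hM₁ hM₂⟩

/-- **Blum–Kannan's criterion for languages, unconditionally**: `L` has an instance checker iff
both `L` and `Lᶜ` are in `frIP`. [cite: FortnowRompelSipser1994, §3 (p. 550)]
[cite: BlumKannan1995, Thm. 7.1 (p. 288)] -/
theorem instanceCheckable_iff_mem_frIP (L : Language Bool) :
    InstanceCheckable L ↔ L ∈ frIP ∧ Lᶜ ∈ frIP :=
  instanceCheckable_iff.language instanceCheckable_iff_holds L

end Literature.Computability.Complexity
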